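import Summits.Ventures.PercRepro.RankLevelSetColoopDevice
import Summits.Ventures.PercRepro.RankLevelSetColoopDeviceRowsArith
import Summits.Ventures.PercRepro.RankLevelSetDepCount
import Summits.Ventures.PercRepro.RankLevelSetLevelSixCapGlue25

/-!
# PercRepro — THE TRIVIAL ROWS OF THE COLOOP DEVICE at the 22 row (p8 g13, S3)

With `K` the coloops of a core `M` of rank `22` (`k = |K|`) and `M₀ = M ＼ K` of rank `p₀ = 22 − k` on `n = p₀ + d` points,
the device (`RLS_of_coloops_device`) asks for `Φ(22, 6)·#U_{M₀}(p₀, 6) ≤ Σ_{i ≤ k} C(k, i)·N_i`,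
`N_i = #{A₀ : 6 < r₀(A₀) + i < 22}`. For `k ≥ 7` (`d = 9`) / `k ≥ 8` (`d = 10`) NO cell is needed: the trivial bound
`#U ≤ Σ_{j ≤ d} C(n, j)` (the coindependent complements), and for the windows the tree's nullity cap of the core
(`nullity_cap_core`: a set of rank `r ≤ 4` has `≤ r + cnull r` points, `cnull = 0, 0, 1, 3, 6`), so that
`N_i ≥ 2^n − Σ_{j ≤ (6−i) + cnull(6−i)} C(n, j)` for `2 ≤ i ≤ 6`, `N_i = 2^n` for `6 < i < k`, and the spanning sets
(`ncard_spanning_le`) at `i = k` (`rowLB`, `rowLB_le_midShift`); the windows `i ≤ 1` are dropped. One `norm_num` per `k`.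
Ratios (tools/rows_plan2.py): `d = 9`: `k = 7 … 16`: 0.959 / 0.608 / 0.384 / 0.239 / 0.147 / 0.088 / 0.052 / 0.030 / 0.017 / 0.009;
`d = 10`: `k = 8 … 16`: 0.806 / 0.493 / 0.298 / 0.177 / 0.104 / 0.059 / 0.033 / 0.018 / 0.010 (`Φ ≤ 2^{28}/C(28, 6)`).

Axioms: standard.
-/

open Set
open scoped Matroid

namespace PercRepro

namespace Matroid

variable {α : Type} {M : _root_.Matroid α} [M.Finite]

omit [M.Finite] in
/-- `#{A ⊆ E : r(A) + i ≤ q} = 0` when `q < i`. -/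
theorem ncard_shift_le_eq_zero {i q : ℕ} (hqi : q < i) :
    {A : Set α | A ⊆ M.E ∧ M.eRk A + (i : ℕ∞) ≤ (q : ℕ∞)}.ncard = 0 := by
  have h : {A : Set α | A ⊆ M.E ∧ M.eRk A + (i : ℕ∞) ≤ (q : ℕ∞)} = ∅ := by
    ext A
    simp only [Set.mem_setOf_eq, Set.mem_empty_iff_false, iff_false, not_and]
    intro _ h
    have h1 : (i : ℕ∞) ≤ M.eRk A + (i : ℕ∞) := le_add_self
    have h2 : (q : ℕ∞) < (i : ℕ∞) := by exact_mod_cast hqi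
    exact absurd (h1.trans h) (not_le.mpr h2)
  rw [h, Set.ncard_empty]

/-- On an `e`-free core, `#{A ⊆ E : r(A) + i ≤ q} ≤ Σ_{j ≤ (q−i) + cnull (q−i)} C(n, j)` for `i ≤ q`, `q − i ≤ 4`
(the nullity cap `nullity_cap_core`). -/
theorem ncard_shift_le_le_of_free
    (hfree : ∀ e ∈ M.E, ∃ A ⊆ M.E \ {e}, e ∉ M.closure A ∧ e ∉ M.closure ((M.E \ {e}) \ A))
    {i q : ℕ} (hiq : i ≤ q) (hr4 : q - i ≤ 4) :
    {A : Set α | A ⊆ M.E ∧ M.eRk A + (i : ℕ∞) ≤ (q : ℕ∞)}.ncard ≤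
      ∑ j ∈ Finset.range (q - i + cnull (q - i) + 1), M.ground_finite.toFinset.card.choose j := by
  have hE : (M.ground_finite.toFinset : Set α) = M.E := Set.Finite.coe_toFinset _
  calc {A : Set α | A ⊆ M.E ∧ M.eRk A + (i : ℕ∞) ≤ (q : ℕ∞)}.ncard
      ≤ {X : Set α | X ⊆ (M.ground_finite.toFinset : Set α) ∧ X.ncard ≤ q - i + cnull (q - i)}.ncard := by
        apply Set.ncard_le_ncard
        · intro A hA
          obtain ⟨hAE, hr⟩ := hA
          refine ⟨by rw [hE]; exact hAE, ?_⟩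
          have hr' : M.eRk A ≤ ((q - i : ℕ) : ℕ∞) := by
            have h1 : M.eRk A + (i : ℕ∞) ≤ ((q - i : ℕ) : ℕ∞) + (i : ℕ∞) := by
              rw [← Nat.cast_add, Nat.sub_add_cancel hiq]; exact hr
            exact (WithTop.add_le_add_iff_right (ENat.coe_ne_top i)).1 h1
          have hcap := ThmN.nullity_cap_core M hfree (q - i) hr4 A hAE hr'
          have h2 : (A.ncard : ℕ∞) ≤ ((q - i + cnull (q - i) : ℕ) : ℕ∞) := by
            calc (A.ncard : ℕ∞) ≤ M.eRk A + cnull (q - i) := hcap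
              _ ≤ ((q - i : ℕ) : ℕ∞) + cnull (q - i) := by gcongr
              _ = ((q - i + cnull (q - i) : ℕ) : ℕ∞) := by push_cast; rfl
          exact_mod_cast h2
        · exact (Finset.finite_toSet _).finite_subsets.subset (fun X hX => hX.1)
    _ ≤ _ := ncard_subsets_ncard_le _ _

omit [M.Finite] in
/-- `#{A ⊆ E : p ≤ r(A) + i} = 0` when `r(M) + i < p`. -/
theorem ncard_shift_ge_eq_zero {p p₀ i : ℕ} (hR : M.eRank = (p₀ : ℕ∞)) (h : p₀ + i < p) :
    {A : Set α | A ⊆ M.E ∧ (p : ℕ∞) ≤ M.eRk A + (i : ℕ∞)}.ncard = 0 := by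
  have hempty : {A : Set α | A ⊆ M.E ∧ (p : ℕ∞) ≤ M.eRk A + (i : ℕ∞)} = ∅ := by
    ext A
    simp only [Set.mem_setOf_eq, Set.mem_empty_iff_false, iff_false, not_and]
    intro _ hle
    have h1 : M.eRk A + (i : ℕ∞) ≤ (p₀ : ℕ∞) + (i : ℕ∞) := by
      gcongr
      rw [← hR]; exact M.eRk_le_eRank A
    have h2 : ((p₀ + i : ℕ) : ℕ∞) < (p : ℕ∞) := by exact_mod_cast h
    push_cast at h2
    exact absurd (hle.trans h1) (not_le.mpr h2)
  rw [hempty, Set.ncard_empty]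

/-- `#{A ⊆ E : p₀ + k ≤ r(A) + k} ≤ Σ_{j ≤ d} C(n, j)` — these are the spanning sets (`ncard_spanning_le`). -/
theorem ncard_shift_ge_le_spanning {p₀ k d : ℕ} (hR : M.eRank = (p₀ : ℕ∞)) (hd : M.E.encard = M.eRank + d) :
    {A : Set α | A ⊆ M.E ∧ ((p₀ + k : ℕ) : ℕ∞) ≤ M.eRk A + (k : ℕ∞)}.ncard ≤
      ∑ j ∈ Finset.range (d + 1), M.ground_finite.toFinset.card.choose j := by
  refine le_trans (Set.ncard_le_ncard ?_ (M.ground_finite.finite_subsets.subset fun X hX => hX.1))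
    (ncard_spanning_le hd)
  intro A hA
  obtain ⟨hAE, hle⟩ := hA
  refine ⟨hAE, le_antisymm (M.eRk_le_eRank A) ?_⟩
  rw [hR]
  have h1 : (p₀ : ℕ∞) + (k : ℕ∞) ≤ M.eRk A + (k : ℕ∞) := by push_cast at hle; exact hle
  exact (WithTop.add_le_add_iff_right (ENat.coe_ne_top k)).1 h1

/-- **`rowLB ≤ N_i`** on an `e`-free core of rank `p₀` with `|E| = r(M) + d`, for `i ≤ k`. -/
theorem rowLB_le_midShift
    (hfree : ∀ e ∈ M.E, ∃ A ⊆ M.E \ {e}, e ∉ M.closure A ∧ e ∉ M.closure ((M.E \ {e}) \ A))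
    {p₀ k d q : ℕ} (hR : M.eRank = (p₀ : ℕ∞)) (hd : M.E.encard = M.eRank + d) {i : ℕ} (hik : i ≤ k) :
    rowLB M.ground_finite.toFinset.card d k q i ≤ midShift M i (p₀ + k) q := by
  have h2 := two_pow_le_midShift_add (M := M) i (p₀ + k) q
  have hL : {X : Set α | X ⊆ M.E ∧ M.eRk X + (i : ℕ∞) ≤ (q : ℕ∞)}.ncard ≤
      (if q < i then 0 else if q - i ≤ 4 then
        ∑ j ∈ Finset.range (q - i + cnull (q - i) + 1), M.ground_finite.toFinset.card.choose j
      else 2 ^ M.ground_finite.toFinset.card) := by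
    split_ifs with h1 h3
    · exact (ncard_shift_le_eq_zero h1).le
    · exact ncard_shift_le_le_of_free hfree (not_lt.1 h1) h3
    · rw [← ncard_subsets_eq]
      apply Set.ncard_le_ncard
      · intro X hX
        rw [Set.Finite.coe_toFinset]
        exact hX.1
      · exact (Finset.finite_toSet _).finite_subsets
  have hG : {X : Set α | X ⊆ M.E ∧ ((p₀ + k : ℕ) : ℕ∞) ≤ M.eRk X + (i : ℕ∞)}.ncard ≤
      (if i = k then ∑ j ∈ Finset.range (d + 1), M.ground_finite.toFinset.card.choose j else 0) := by
    split_ifs with h1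
    · subst h1
      exact ncard_shift_ge_le_spanning hR hd
    · exact (ncard_shift_ge_eq_zero hR (by omega)).le
  unfold rowLB
  omega

/-- **The trivial top bound**: `#U(p₀, q) ≤ Σ_{j ≤ d} C(n, j)` (the complements of the members of `U` are coindependent,
hence have `≤ d` elements: `topCount_le_ncard_compl`). -/
theorem topCount_le_sum_choose {p₀ d : ℕ} (hR : M.eRank = (p₀ : ℕ∞)) (hd : M.E.encard = M.eRank + d) (q : ℕ) :
    topCount M p₀ q ≤ ∑ j ∈ Finset.range (d + 1), M.ground_finite.toFinset.card.choose j := by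
  refine (topCount_le_ncard_compl hR hd q).trans ?_
  refine le_trans (Set.ncard_le_ncard ?_ ((Finset.finite_toSet _).finite_subsets.subset fun X hX => hX.1))
    (ncard_subsets_ncard_le _ _)
  intro B hB
  exact ⟨by rw [Set.Finite.coe_toFinset]; exact hB.1, hB.2.2⟩

end Matroid

namespace ThmN

open Matroid

variable {α : Type}

/-- **The trivial rows of `(22, 9)`**: for the coloop-free part of rank `22 − k`, `7 ≤ k ≤ 22`, corank `9`, the device's
inequality holds with the trivial top bound and the nullity-cap window bounds (ratio `0.959` at `k = 7`, then `≤ 0.61`). -/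
theorem c025_t22_nine_rows (M : Matroid α) [M.Finite] {k : ℕ} (hk7 : 7 ≤ k) (hk : k ≤ 22)
    (hR : M.eRank = ((22 - k : ℕ) : ℕ∞)) (hn : M.E.ncard = 22 - k + 9)
    (hfree : ∀ e ∈ M.E, ∃ A ⊆ M.E \ {e}, e ∉ M.closure A ∧ e ∉ M.closure ((M.E \ {e}) \ A)) :
    phiK 22 6 * (Matroid.topCount M (22 - k) 6 : ℚ) ≤
      ∑ i ∈ Finset.range (k + 1), ((k.choose i : ℕ) : ℚ) * (Matroid.midShift M i 22 6 : ℚ) := by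
  have hEcard : M.ground_finite.toFinset.card = 22 - k + 9 := by
    rw [← Set.ncard_eq_toFinset_card _ M.ground_finite]; exact hn
  have hd : M.E.encard = M.eRank + (9 : ℕ) := by
    rw [hR, ← M.ground_finite.cast_ncard_eq, hn]
    push_cast
    ring
  have hp : 22 - k + k = 22 := by omega
  have htop : (Matroid.topCount M (22 - k) 6 : ℚ) ≤
      ((∑ j ∈ Finset.range (9 + 1), (22 - k + 9).choose j : ℕ) : ℚ) := by
    have h := topCount_le_sum_choose (M := M) hR hd 6
    rw [hEcard] at h
    exact_mod_cast h
  have hlb : ∀ i ∈ Finset.range (k + 1),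
      ((k.choose i : ℕ) : ℚ) * ((rowLB (22 - k + 9) 9 k 6 i : ℕ) : ℚ) ≤
        ((k.choose i : ℕ) : ℚ) * (Matroid.midShift M i 22 6 : ℚ) := by
    intro i hi
    rw [Finset.mem_range] at hi
    have h := rowLB_le_midShift (M := M) hfree (k := k) (q := 6) hR hd (i := i) (by omega)
    rw [hEcard, hp] at h
    exact mul_le_mul_of_nonneg_left (Nat.cast_le.mpr h) (Nat.cast_nonneg _)
  have hsum : ((∑ i ∈ Finset.range (k + 1), k.choose i * rowLB (22 - k + 9) 9 k 6 i : ℕ) : ℚ) ≤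
      ∑ i ∈ Finset.range (k + 1), ((k.choose i : ℕ) : ℚ) * (Matroid.midShift M i 22 6 : ℚ) := by
    push_cast
    exact Finset.sum_le_sum hlb
  have hΦ : phiK 22 6 ≤ (2 : ℚ) ^ 28 / 376740 := by
    have h := phiK_le_two_pow_div_six 22
    norm_num at h
    exact h
  have hnum : 2 ^ 28 * (∑ j ∈ Finset.range (9 + 1), (22 - k + 9).choose j) ≤
      376740 * ∑ i ∈ Finset.range (k + 1), k.choose i * rowLB (22 - k + 9) 9 k 6 i :=
    c025_t22_nine_num k hk7 hk
  have hnumq : (2 : ℚ) ^ 28 * ((∑ j ∈ Finset.range (9 + 1), (22 - k + 9).choose j : ℕ) : ℚ) ≤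
      376740 * ((∑ i ∈ Finset.range (k + 1), k.choose i * rowLB (22 - k + 9) 9 k 6 i : ℕ) : ℚ) := by
    exact_mod_cast hnum
  have hU0 : (0 : ℚ) ≤ (Matroid.topCount M (22 - k) 6 : ℚ) := Nat.cast_nonneg _
  have hS : (2 : ℚ) ^ 28 / 376740 * ((∑ j ∈ Finset.range (9 + 1), (22 - k + 9).choose j : ℕ) : ℚ) ≤
      ((∑ i ∈ Finset.range (k + 1), k.choose i * rowLB (22 - k + 9) 9 k 6 i : ℕ) : ℚ) := by
    rw [div_mul_eq_mul_div, div_le_iff₀ (by norm_num)]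
    linarith
  calc phiK 22 6 * (Matroid.topCount M (22 - k) 6 : ℚ)
      ≤ (2 : ℚ) ^ 28 / 376740 * (Matroid.topCount M (22 - k) 6 : ℚ) :=
        mul_le_mul_of_nonneg_right hΦ hU0
    _ ≤ (2 : ℚ) ^ 28 / 376740 * ((∑ j ∈ Finset.range (9 + 1), (22 - k + 9).choose j : ℕ) : ℚ) :=
        mul_le_mul_of_nonneg_left htop (by norm_num)
    _ ≤ _ := hS.trans hsum

/-- **The trivial rows of `(22, 10)`**: for the coloop-free part of rank `22 − k`, `8 ≤ k ≤ 22`, corank `10`, the device's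
inequality holds with the trivial top bound and the nullity-cap window bounds (ratio `0.806` at `k = 8`, then `≤ 0.50`). -/
theorem c025_t22_ten_rows (M : Matroid α) [M.Finite] {k : ℕ} (hk8 : 8 ≤ k) (hk : k ≤ 22)
    (hR : M.eRank = ((22 - k : ℕ) : ℕ∞)) (hn : M.E.ncard = 22 - k + 10)
    (hfree : ∀ e ∈ M.E, ∃ A ⊆ M.E \ {e}, e ∉ M.closure A ∧ e ∉ M.closure ((M.E \ {e}) \ A)) :
    phiK 22 6 * (Matroid.topCount M (22 - k) 6 : ℚ) ≤
      ∑ i ∈ Finset.range (k + 1), ((k.choose i : ℕ) : ℚ) * (Matroid.midShift M i 22 6 : ℚ) := by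
  have hEcard : M.ground_finite.toFinset.card = 22 - k + 10 := by
    rw [← Set.ncard_eq_toFinset_card _ M.ground_finite]; exact hn
  have hd : M.E.encard = M.eRank + (10 : ℕ) := by
    rw [hR, ← M.ground_finite.cast_ncard_eq, hn]
    push_cast
    ring
  have hp : 22 - k + k = 22 := by omega
  have htop : (Matroid.topCount M (22 - k) 6 : ℚ) ≤
      ((∑ j ∈ Finset.range (10 + 1), (22 - k + 10).choose j : ℕ) : ℚ) := by
    have h := topCount_le_sum_choose (M := M) hR hd 6
    rw [hEcard] at h
    exact_mod_cast h
  have hlb : ∀ i ∈ Finset.range (k + 1),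
      ((k.choose i : ℕ) : ℚ) * ((rowLB (22 - k + 10) 10 k 6 i : ℕ) : ℚ) ≤
        ((k.choose i : ℕ) : ℚ) * (Matroid.midShift M i 22 6 : ℚ) := by
    intro i hi
    rw [Finset.mem_range] at hi
    have h := rowLB_le_midShift (M := M) hfree (k := k) (q := 6) hR hd (i := i) (by omega)
    rw [hEcard, hp] at h
    exact mul_le_mul_of_nonneg_left (Nat.cast_le.mpr h) (Nat.cast_nonneg _)
  have hsum : ((∑ i ∈ Finset.range (k + 1), k.choose i * rowLB (22 - k + 10) 10 k 6 i : ℕ) : ℚ) ≤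
      ∑ i ∈ Finset.range (k + 1), ((k.choose i : ℕ) : ℚ) * (Matroid.midShift M i 22 6 : ℚ) := by
    push_cast
    exact Finset.sum_le_sum hlb
  have hΦ : phiK 22 6 ≤ (2 : ℚ) ^ 28 / 376740 := by
    have h := phiK_le_two_pow_div_six 22
    norm_num at h
    exact h
  have hnum : 2 ^ 28 * (∑ j ∈ Finset.range (10 + 1), (22 - k + 10).choose j) ≤
      376740 * ∑ i ∈ Finset.range (k + 1), k.choose i * rowLB (22 - k + 10) 10 k 6 i :=
    c025_t22_ten_num k hk8 hk
  have hnumq : (2 : ℚ) ^ 28 * ((∑ j ∈ Finset.range (10 + 1), (22 - k + 10).choose j : ℕ) : ℚ) ≤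
      376740 * ((∑ i ∈ Finset.range (k + 1), k.choose i * rowLB (22 - k + 10) 10 k 6 i : ℕ) : ℚ) := by
    exact_mod_cast hnum
  have hU0 : (0 : ℚ) ≤ (Matroid.topCount M (22 - k) 6 : ℚ) := Nat.cast_nonneg _
  have hS : (2 : ℚ) ^ 28 / 376740 * ((∑ j ∈ Finset.range (10 + 1), (22 - k + 10).choose j : ℕ) : ℚ) ≤
      ((∑ i ∈ Finset.range (k + 1), k.choose i * rowLB (22 - k + 10) 10 k 6 i : ℕ) : ℚ) := by
    rw [div_mul_eq_mul_div, div_le_iff₀ (by norm_num)]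
    linarith
  calc phiK 22 6 * (Matroid.topCount M (22 - k) 6 : ℚ)
      ≤ (2 : ℚ) ^ 28 / 376740 * (Matroid.topCount M (22 - k) 6 : ℚ) :=
        mul_le_mul_of_nonneg_right hΦ hU0
    _ ≤ (2 : ℚ) ^ 28 / 376740 * ((∑ j ∈ Finset.range (10 + 1), (22 - k + 10).choose j : ℕ) : ℚ) :=
        mul_le_mul_of_nonneg_left htop (by norm_num)
    _ ≤ _ := hS.trans hsum

/-- **THE CELL `(22, 9)` WITH `≥ 7` COLOOPS**: every `e`-free core of rank `22`, corank `9`, with at least `7` coloops satisfies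
`RLS M 22 6` — the device on the coloop set `K` and the trivial rows (no cell of the counting method is used). -/
theorem c025_core_six_twentytwo_nine_of_coloops (M : Matroid α) [M.Finite]
    (hR : M.eRank = (22 : ℕ∞)) (hn : M.E.ncard = 22 + 9)
    (hfree : ∀ e ∈ M.E, ∃ A ⊆ M.E \ {e}, e ∉ M.closure A ∧ e ∉ M.closure ((M.E \ {e}) \ A))
    (h7 : 7 ≤ M.coloops.ncard) : RLS M 22 6 := by
  classical
  have hfin : M.coloops.Finite := M.ground_finite.subset (Matroid.coloops_subset_ground M)
  set K : Finset α := hfin.toFinset with hKdef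
  have hK : ∀ e ∈ K, M.IsColoop e := fun e he => by
    rw [hKdef, Set.Finite.mem_toFinset] at he
    exact he
  have hcard : K.card = M.coloops.ncard := by rw [hKdef, Set.ncard_eq_toFinset_card _ hfin]
  have hR' : M.eRank = ((22 : ℕ) : ℕ∞) := hR
  obtain ⟨hn0, hR0, hfree0, hk⟩ := delete_coloops_core_data M K hK hR' hn hfree
  have h := c025_t22_nine_rows (M ＼ (K : Set α)) (k := K.card) (by omega) hk hR0 hn0 hfree0
  exact RLS_of_coloops_device M K hK (q := 5) (by norm_num) hR' h

/-- **THE CELL `(22, 10)` WITH `≥ 8` COLOOPS**: every `e`-free core of rank `22`, corank `10`, with at least `8` coloops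
satisfies `RLS M 22 6`. -/
theorem c025_core_six_twentytwo_ten_of_coloops (M : Matroid α) [M.Finite]
    (hR : M.eRank = (22 : ℕ∞)) (hn : M.E.ncard = 22 + 10)
    (hfree : ∀ e ∈ M.E, ∃ A ⊆ M.E \ {e}, e ∉ M.closure A ∧ e ∉ M.closure ((M.E \ {e}) \ A))
    (h8 : 8 ≤ M.coloops.ncard) : RLS M 22 6 := by
  classical
  have hfin : M.coloops.Finite := M.ground_finite.subset (Matroid.coloops_subset_ground M)
  set K : Finset α := hfin.toFinset with hKdef
  have hK : ∀ e ∈ K, M.IsColoop e := fun e he => by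
    rw [hKdef, Set.Finite.mem_toFinset] at he
    exact he
  have hcard : K.card = M.coloops.ncard := by rw [hKdef, Set.ncard_eq_toFinset_card _ hfin]
  have hR' : M.eRank = ((22 : ℕ) : ℕ∞) := hR
  obtain ⟨hn0, hR0, hfree0, hk⟩ := delete_coloops_core_data M K hK hR' hn hfree
  have h := c025_t22_ten_rows (M ＼ (K : Set α)) (k := K.card) (by omega) hk hR0 hn0 hfree0
  exact RLS_of_coloops_device M K hK (q := 5) (by norm_num) hR' h

end ThmN

end PercRepro
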